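import Summits.KontsevichZagierPeriods.KontsevichZagierPeriods.Theses.HurwitzMicroSectors
import Summits.KontsevichZagierPeriods.KontsevichZagierPeriods.Theorems.HurwitzMicroSectorsNormalFormPrinciplePiBoxTransfer
import Summits.KontsevichZagierPeriods.KontsevichZagierPeriods.Theorems.HurwitzMicroSectorsNormalFormPrincipleVariants2239
import Summits.KontsevichZagierPeriods.KontsevichZagierPeriods.Theorems.HurwitzMicroSectorsNormalFormPrincipleVariants2290

/-! TTRL-lite variant V2291 of stmt-KontsevichZagierPeriods-3869

Variant V2291 = `stub_boxRigidity` (the leaf `BoxRigidity` of `NormalFormPrinciple`: two BOX-RATIONAL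
representations — domain the open unit box, integrand `p/q` over `ℚ`, `q ≠ 0` on the box — with equal
values are KZ-equivalent) under the JOINT bound `bound_nat:m≤5; bound_nat:m'≤4`. Verdict of the
attempt seat: **open** — this file is the exact-strength certificate, not a proof of the variant.
* `V2291 ⟺ BoxVanishing 5` (`stub_boxRigidity_var2291_iff_boxVanishing_five`): the instance
  `(j, k) = (5, 4)` of the tree's `boxRigidityLe_iff_boxVanishing` (file `…Variants2239`: a joint bound
  is the single dimension `max j k`; forward, compare a vanishing representation on `(0,1)⁵` with the
  zero representation on the `0`-box; backward, pad both representations to `(0,1)⁵` by unit intervals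
  and subtract on the common box, value `0` by soundness);
* hence `V2291 ⟺ BoxRigidity for all m, m' ≤ 5` (`stub_boxRigidity_var2291_iff_le_five`): the bound
  `m' ≤ 4` is idle, and V2291 coincides with its sibling V2290 (`fix_nat:m=5; bound_nat:m'≤4`,
  `stub_boxRigidity_var2291_iff_var2290`);
* `KontsevichZagierPeriods ⟹ parent leaf ⟹ V2291` (`stub_boxRigidity_var2291_of_statement`,
  `stub_boxRigidity_var2291_of_parent`), so a refutation of V2291 would refute the Summit; the tree has
  no invariant of `KZ.relations` finer than `eval` (soundness) with which to attempt one.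
Why open: BoxVanishing 5 contains BoxVanishing 2 (`boxVanishing_mono`), i.e. every vanishing absolutely
convergent `∫∫_{(0,1)²} p/q` (`p, q ∈ ℚ[x, y]`) is generated by the four moves; for the Catalan family
`[(0,1)², 1/(1+x²y²) − c]` (`c : ℚ`, value `G − c`) a chain of moves at `c` forces `G = c` by soundness,
so a proof needs irrationality-type input for `G` (open); dimension `5` adds `ζ(5)`, `π²ζ(3)` against
rational constants. The tree's two-sided knowledge stops at `m, m' ≤ 1` (`boxRigidity_of_le_one`, Baker).
Residual goal: `BoxVanishing 5`.
Source: M. Kontsevich, D. Zagier, *Periods* (2001), §1.2 Conjecture 1 and rules 1)–3).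
Pure proof file, no definitions. -/

-- `Summit.<Summit>.<Problem>` is the tree's mandated summit-side namespace (CONVENTIONS §2); for this
-- single-conjunct summit the two coincide, so the duplicate is deliberate.
set_option linter.dupNamespace false

noncomputable section

namespace Summit.KontsevichZagierPeriods.KontsevichZagierPeriods.Theorems

open MeasureTheory Set
open Literature.NumberTheory.Transcendental Literature.NumberTheory.Transcendental.KZ
open Summit.KontsevichZagierPeriods.KontsevichZagierPeriods.Theses.HurwitzMicroSectors
open Summit.KontsevichZagierPeriods.HurwitzMicroSectors.NormalFormPrinciple.PiBox

/-! ## The variant V2291 is exactly `BoxVanishing 5` -/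

/-- **V2291 ⟺ BoxVanishing in dimension `5`** (every box-rational representation on `(0,1)⁵` of value
`0` is a KZ relation): instance `(j, k) = (5, 4)` of `boxRigidityLe_iff_boxVanishing` — forward by
comparison with the zero representation on the `0`-box, backward by padding to `(0,1)⁵` and subtracting.
[cite: KontsevichZagier2001, §1.2 Conjecture 1] -/
theorem stub_boxRigidity_var2291_iff_boxVanishing_five :
    (∀ (m m' : ℕ) (N : IntegralRep m) (N' : IntegralRep m'), m' ≤ 4 → m ≤ 5 → N.domain = {x | ∀ i, x i ∈ Set.Ioo (0:ℝ) 1} → N.IsRational → N'.domain = {x | ∀ i, x i ∈ Set.Ioo (0:ℝ) 1} → N'.IsRational → N.value = N'.value → Equivalent N N') ↔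
    (∀ N : IntegralRep 5, N.domain = {x | ∀ i, x i ∈ Set.Ioo (0:ℝ) 1} → N.IsRational →
      N.value = 0 → of N ∈ relations) :=
  ⟨fun h => boxVanishing_of_boxRigidityLe le_rfl h,
    fun h => boxRigidityLe_of_boxVanishing le_rfl (by norm_num) h⟩

/-- **V2291 ⟺ BoxRigidity under the joint bound `m, m' ≤ 5`** (the honest strength of the variant:
Conjecture 1 for all pairs of rational integrands on the open unit boxes of dimension at most `5`; the
bound `m' ≤ 4` is idle). [cite: KontsevichZagier2001, §1.2 Conjecture 1] -/
theorem stub_boxRigidity_var2291_iff_le_five :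
    (∀ (m m' : ℕ) (N : IntegralRep m) (N' : IntegralRep m'), m' ≤ 4 → m ≤ 5 → N.domain = {x | ∀ i, x i ∈ Set.Ioo (0:ℝ) 1} → N.IsRational → N'.domain = {x | ∀ i, x i ∈ Set.Ioo (0:ℝ) 1} → N'.IsRational → N.value = N'.value → Equivalent N N') ↔
    (∀ (m m' : ℕ) (N : IntegralRep m) (N' : IntegralRep m'), m' ≤ 5 → m ≤ 5 →
      N.domain = {x | ∀ i, x i ∈ Set.Ioo (0:ℝ) 1} → N.IsRational →
      N'.domain = {x | ∀ i, x i ∈ Set.Ioo (0:ℝ) 1} → N'.IsRational →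
      N.value = N'.value → Equivalent N N') :=
  ⟨fun h => boxRigidityLe_of_boxVanishing le_rfl le_rfl
      (stub_boxRigidity_var2291_iff_boxVanishing_five.1 h),
    fun h m m' N N' hm' hm => h m m' N N' (hm'.trans (by norm_num)) hm⟩

/-- **V2291 ⟺ the sibling V2290** (`fix_nat:m=5; bound_nat:m'≤4`): both are `BoxVanishing 5`
(`stub_boxRigidity_var2290_iff_boxVanishing_five`, file `…Variants2290`) — freezing `m := 5` loses
nothing against the bound `m ≤ 5`. [cite: KontsevichZagier2001, §1.2 Conjecture 1] -/
theorem stub_boxRigidity_var2291_iff_var2290 :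
    (∀ (m m' : ℕ) (N : IntegralRep m) (N' : IntegralRep m'), m' ≤ 4 → m ≤ 5 → N.domain = {x | ∀ i, x i ∈ Set.Ioo (0:ℝ) 1} → N.IsRational → N'.domain = {x | ∀ i, x i ∈ Set.Ioo (0:ℝ) 1} → N'.IsRational → N.value = N'.value → Equivalent N N') ↔
    (∀ (m' : ℕ) (N : IntegralRep 5) (N' : IntegralRep m'), m' ≤ 4 → N.domain = {x | ∀ i, x i ∈ Set.Ioo (0:ℝ) 1} → N.IsRational → N'.domain = {x | ∀ i, x i ∈ Set.Ioo (0:ℝ) 1} → N'.IsRational → N.value = N'.value → Equivalent N N') :=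
  stub_boxRigidity_var2291_iff_boxVanishing_five.trans
    stub_boxRigidity_var2290_iff_boxVanishing_five.symm

/-! ## Downward consequence -/

/-- **V2291 ⇒ BoxVanishing in every dimension `≤ 5`** (monotonicity along padding,
`boxVanishing_mono`); the first open level is `2` (the Catalan family `[(0,1)², 1/(1+x²y²) − c]`).
[cite: KontsevichZagier2001, §1.2 Conjecture 1] -/
theorem boxVanishing_le_five_of_stub_boxRigidity_var2291
    (h : ∀ (m m' : ℕ) (N : IntegralRep m) (N' : IntegralRep m'), m' ≤ 4 → m ≤ 5 → N.domain = {x | ∀ i, x i ∈ Set.Ioo (0:ℝ) 1} → N.IsRational → N'.domain = {x | ∀ i, x i ∈ Set.Ioo (0:ℝ) 1} → N'.IsRational → N.value = N'.value → Equivalent N N')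
    {j : ℕ} (hj : j ≤ 5) (N : IntegralRep j) (hNd : N.domain = {x | ∀ i, x i ∈ Set.Ioo (0:ℝ) 1})
    (hNr : N.IsRational) (hv : N.value = 0) : of N ∈ relations :=
  boxVanishing_mono hj (stub_boxRigidity_var2291_iff_boxVanishing_five.1 h) N hNd hNr hv

/-! ## Upper bounds: the parent leaf and the Summit imply V2291 -/

/-- **The parent leaf ⇒ V2291** (drop both bounds; the converse is not claimed — the parent is
`BoxVanishing` in ALL dimensions, the variant only in dimension `5`).
[cite: KontsevichZagier2001, §1.2 Conjecture 1] -/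
theorem stub_boxRigidity_var2291_of_parent
    (h : ∀ (m m' : ℕ) (N : IntegralRep m) (N' : IntegralRep m'), N.domain = {x | ∀ i, x i ∈ Set.Ioo (0:ℝ) 1} → N.IsRational → N'.domain = {x | ∀ i, x i ∈ Set.Ioo (0:ℝ) 1} → N'.IsRational → N.value = N'.value → Equivalent N N') :
    ∀ (m m' : ℕ) (N : IntegralRep m) (N' : IntegralRep m'), m' ≤ 4 → m ≤ 5 → N.domain = {x | ∀ i, x i ∈ Set.Ioo (0:ℝ) 1} → N.IsRational → N'.domain = {x | ∀ i, x i ∈ Set.Ioo (0:ℝ) 1} → N'.IsRational → N.value = N'.value → Equivalent N N' :=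
  fun m m' N N' _ _ => h m m' N N'

/-- **`KontsevichZagierPeriods ⇒ V2291`**: the variant is a special case of Conjecture 1 for the
tree's calculus (`leaves_of_statement`) — so a refutation of the variant would refute the Summit.
[cite: KontsevichZagier2001, §1.2 Conjecture 1] -/
theorem stub_boxRigidity_var2291_of_statement (h : _root_.KontsevichZagierPeriods) :
    ∀ (m m' : ℕ) (N : IntegralRep m) (N' : IntegralRep m'), m' ≤ 4 → m ≤ 5 → N.domain = {x | ∀ i, x i ∈ Set.Ioo (0:ℝ) 1} → N.IsRational → N'.domain = {x | ∀ i, x i ∈ Set.Ioo (0:ℝ) 1} → N'.IsRational → N.value = N'.value → Equivalent N N' :=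
  stub_boxRigidity_var2291_of_parent (leaves_of_statement h).1

end Summit.KontsevichZagierPeriods.KontsevichZagierPeriods.Theorems

end
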